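/-
Copyright (c) 2026. All rights reserved.
Released under Apache 2.0 license as described in the file LICENSE.
Authors: abc-iut cell, prover seat abc-iut-L4-t15 (wave 2), over the statements of abc-iut-L4-t3.
-/
import Literature.AnabelianGeometry.AbsoluteAnabelian.DiagramCores
import Literature.AnabelianGeometry.AbsoluteAnabelian.Ltimes.LogFrobeniusCorollaries
import Literature.AnabelianGeometry.AbsoluteAnabelian.LogFrobeniusCoresProofs

/-!
# [AbsTopIII] Corollary 5.5 (i): the cores of `D•` — DISCHARGE of `LogFrobeniusSetting.Cor55Cores`

S. Mochizuki, *Topics in absolute anabelian geometry III: global reconstruction algorithms*,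
J. Math. Sci. Univ. Tokyo 22 (2015) 939–1156 [MochizukiAbsTopIII2015]; locators `p.N` = pages of the author's
manuscript (`paper:url-5493eb38cbb7`), read on the page: Cor 5.5 (i) p. 130, its proof p. 132 l. 22–23
("Assertions (i), (ii) are immediate from the definitions — cf. also the proofs of Corollary 3.6, (i), (ii);
Corollary 4.5, (i), (ii).").

Proof-only companion (theorems only, no new notions) of abc-iut-L4-t3's
`LogFrobeniusCorollaries.lean`, which states Cor 5.5 (i) — "for `n = 5, 6, 7`, `D•_{≤n}` admits a natural structure of
core on `D•_{≤n-1}`" — as the named `Prop` fact `LogFrobeniusSetting.Cor55Cores L` over the interface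
`LogFrobeniusSetting L` (`LogFrobeniusCompatibility.lean`), with the honest Def 3.5 (iii) notion of core of
abc-iut-L4-t2 (`DiagramsOfCategories.lean`: the family of homotopies relates ALL co-verticial pairs of paths into
the observation vertex, and every vertex reaches it).  Here that fact is PROVED for every setting `L` whose index
set `V(F_mod)` is nonempty (`cor55Cores_holds`), by the mechanism the printed proof points to (the proofs of
Cor 3.6 (i) / 4.5 (i): every category of the diagram "lies over" the core category), made a construction by
abc-iut-L4-t12's toolkit `DiagramCores.lean` (`OverData` ⟹ `coreObservable` ⟹ `isCore_coreObservable`):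

* inside `cor55Cores_holds`: the STRUCTURE FUNCTORS of the holomorphic vertices of `D•⊢` over `An•[𝒳]` —
  `𝒳_⋎, □ ↦ (𝒳 → ℰ•) ⋙ κ_{An•}`, `𝒩⊞_v ↦ (𝒩⊞_v → 𝒩_v → ℰ•) ⋙ κ_{An•}`, `𝒩_v ↦ (𝒩_v → ℰ•) ⋙ κ_{An•}`, `ℰ• ↦ κ_{An•}`,
  `An•[𝒳] ↦ id`, `ℰ•` (row 7) `↦ κ₂⁻¹` — and, for every arrow of `D•`, the isomorphism "the arrow lies over
  `An•[𝒳]`", assembled from EXACTLY the interface's own data: `logOver` ("`log` lies over `Th•`"), `lamOver`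
  ("`λ⊞_{v,ν}` lies over `Th•[Z]`"), and the unit isomorphisms of the equivalences `κ_{An•}`, `κ₂`; the induced
  `OverData` on `D•_{≤n}` over any category under `An•[𝒳]` (kept inside the proof: this file is theorem-only);
* `isCoreOn_of_overData`: t3's `IsCoreOn` from such data (the bridge to `isCore_coreObservable`);
* `reach_e5`, `reach_an`, `reach_e7`: every vertex of `D•_{≤4}`, `D•_{≤5}`, `D•_{≤6}` reaches the core vertex
  (`𝒳_⋎ → □ → 𝒩⊞_v → 𝒩_v → ℰ• → An•[𝒳] → ℰ•`, through `λ⊞_{v,space-link}` at some `v ∈ V(F_mod)`);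
* `cor55Cores_holds` (the three printed cores, `n = 5, 6, 7`) and `cor55Cores_iff_nonempty`.

The hypothesis `Nonempty Vmod` (`V(F_mod) ≠ ∅`, automatic for a number field) is NECESSARY for the statement as
typed: with `V(F_mod) = ∅` the vertex `□` has no arrow towards `ℰ•`, so no core structure of `D•_{≤5}` on `D•_{≤4}`
exists (`not_cor55Cores_of_isEmpty`) — a degenerate corner, recorded for the referee, not a defect of print.

NOT here: Cor 5.5 (ii)–(iv) (telecore, observables, log-wall) and Cor 5.10 (iv)(a) (`Cor510MonoCores`, whose
mono-analytic rows need the Def 5.6 (iv) 1-commutativity data — separate file).  Refereed pre-IUT material;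
nothing here bears on [IUTchIII] Cor. 3.12; OUR kernel check of a typed statement, no side taken.

**`⋉`-TWIN (cell row «LTIMES-SUCCESSOR», L4-lead m162; typing finding T3g9-F1).**  This file is the verbatim
re-elaboration of `LogFrobeniusCoresProofs.lean` over the successor interface `LogFrobeniusSettingLtimes`
(`Ltimes/LogFrobeniusCompatibility.lean`: `ι⊞_{v,ε}` indexed by the edges of `Γ⃗^⋉_v` at EVERY place, [AbsTopIII] Cor 5.5 (iii)
p. 131), produced by the cell recipe `LTIMES-RECIPE.md`: names carry over inside `namespace LogFrobeniusSettingLtimes`, the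
section variable is `Lt`, setting-independent declarations are NOT repeated (the originals are in scope), statements and
proofs are otherwise unchanged.  The original file over the frozen interface stays as it is.
-/

set_option autoImplicit false

universe u

open CategoryTheory Quiver

namespace Literature.AnabelianGeometry.AbsoluteAnabelian

namespace LogFrobeniusSettingLtimes

variable {Vmod : Type u} {isArc : Vmod → Bool} (Lt : LogFrobeniusSettingLtimes Vmod isArc)

export LogFrobeniusSetting (spaceLink_isPostLog reach_of_row_le_four inFirstRows_four_of_row_le reach_e5 reach_an reach_e7 eq_core_of_path_of_isEmpty)

/-! ## From structure functors to t3's `IsCoreOn` -/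

/-- **The bridge to Def 3.5 (iii).** A core structure of `D_{≤P} ∪ {x}` on `D_{≤P}` (t3's `IsCoreOn`) from structure
functors over the category at `x` (abc-iut-L4-t12's `OverData`: every arrow of `D_{≤P}` lies over that category)
compatible with the arrows into `x`, provided every vertex of `D_{≤P}` reaches `x`: `coreObservable` /
`isCore_coreObservable` of `DiagramCores.lean`. [cite: MochizukiAbsTopIII2015, Cor 5.5 (i) p.130] -/
theorem isCoreOn_of_overData {P : DVertex Vmod isArc → Prop} {x : DVertex Vmod isArc}
    (O : (Lt.subdiagram P).OverData (x.categoryLtimes Lt))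
    (c : ∀ (a : DSub P) (i : DEdge isArc a.1 x), DEdge.functorLtimes Lt i ≅ O.N a)
    (hreach : ∀ a : DSub P, Nonempty (Path ((obsShape P x).base a) (obsShape P x).obs)) :
    Lt.IsCoreOn P x :=
  ⟨_, _, (Lt.subdiagram P).isCore_coreObservable (obsShape P x)
    (fun _ => (inferInstance : IsEmpty PEmpty.{u + 1})) (Lt.obsExt P x) O c hreach⟩

/-! ## Reachability of the core vertices -/

/-! ## Corollary 5.5 (i): the three cores -/

/-- **Cor 5.5 (i) DISCHARGED**: "For `n = 5, 6, 7`, `D•_{≤n}` admits a natural structure of core on `D•_{≤n-1}`.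
That is to say, loosely speaking, `ℰ•`, `An•[𝒳]` 'form cores' of the functors in `D`" — abc-iut-L4-t3's named fact
`Cor55Cores` holds for EVERY log-Frobenius setting `L` with nonempty `V(F_mod)`.  The proof is the one the text calls
"immediate from the definitions — cf. also the proofs of Corollary 3.6, (i), (ii); Corollary 4.5, (i), (ii)"
(p. 132): every holomorphic vertex of `D•⊢` carries a STRUCTURE FUNCTOR towards `An•[𝒳]` — `𝒳_⋎, □ ↦ (𝒳 → ℰ•) ⋙
κ_{An•}`, `𝒩⊞_v ↦ (𝒩⊞_v → 𝒩_v → ℰ•) ⋙ κ_{An•}`, `𝒩_v ↦ (𝒩_v → ℰ•) ⋙ κ_{An•}`, `ℰ• ↦ κ_{An•}`, `An•[𝒳] ↦ id`,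
`ℰ•` (row 7) `↦ κ₂⁻¹` — and every arrow of `D•` LIES OVER `An•[𝒳]` by an isomorphism assembled from exactly the
interface's own data `logOver` ("`log•_{T,T}` lies over `Th•`"), `lamOver` ("`λ⊞_{v,ν}` lies over `Th•[Z]`") and the
unit isomorphisms of `κ_{An•}`, `κ₂`; composing along paths (abc-iut-L4-t12's `OverData.pathIso` / `coreObservable`)
yields, for each of the three extended sub-diagrams, a family of homotopies relating ALL co-verticial pairs of paths
into the core vertex (over `ℰ•` through `κ_{An•}⁻¹`, over `An•[𝒳]`, over the `ℰ•` of row 7 through `κ₂`).  (For `• = ⊚`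
the further core `ℰ• → EA⊚[Z]` is not part of the typed shape.) [cite: MochizukiAbsTopIII2015, Cor 5.5 (i) p.130] -/
theorem cor55Cores_holds [Nonempty Vmod] : Lt.Cor55Cores := by
  -- the structure functors of the holomorphic vertices over `An•[𝒳]`
  let N : (x : DVertex Vmod isArc) → x.IsHolomorphic → (x.categoryLtimes Lt ⥤ Lt.An) := fun x hx =>
    match x, hx with
    | .row1 _, _ => Lt.proj ⋙ Lt.κAn.functor
    | .core, _ => Lt.proj ⋙ Lt.κAn.functor
    | .nplus v, _ => (Lt.forget v ⋙ Lt.toE v) ⋙ Lt.κAn.functor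
    | .nv v, _ => Lt.toE v ⋙ Lt.κAn.functor
    | .e5, _ => Lt.κAn.functor
    | .an, _ => 𝟭 Lt.An
    | .e7, _ => Lt.κAn₂.inverse
    | .nmonoPlus _, h => False.elim h
    | .nmono _, h => False.elim h
    | .emono5, h => False.elim h
    | .anMono, h => False.elim h
    | .emono7, h => False.elim h
  -- every arrow of `D•` lies over `An•[𝒳]`
  have μ : ∀ {a b : DVertex Vmod isArc} (e : DEdge isArc a b) (ha : a.IsHolomorphic) (hb : b.IsHolomorphic),
      (DEdge.functorLtimes Lt e ⋙ N b hb ≅ N a ha) := fun {a b} e =>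
    match a, b, e with
    | _, _, .log _ => fun _ _ => (Functor.associator _ _ _).symm ≪≫ Functor.isoWhiskerRight Lt.logOver Lt.κAn.functor
    | _, _, .toCore _ => fun _ _ => Functor.leftUnitor _
    | _, _, .lam v ν _ => fun _ _ =>
      (Functor.associator _ _ _).symm ≪≫ Functor.isoWhiskerRight (Lt.lamOver v ν) Lt.κAn.functor
    | _, _, .forget _ => fun _ _ => (Functor.associator _ _ _).symm
    | _, _, .toE _ => fun _ _ => Iso.refl _
    | _, _, .κAn => fun _ _ => Functor.rightUnitor _
    | _, _, .anToE => fun _ _ => Lt.κAn₂.unitIso.symm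
    | _, _, .monoNplus _ => fun _ hb => False.elim hb
    | _, _, .monoN _ => fun _ hb => False.elim hb
    | _, _, .monoE5 => fun _ hb => False.elim hb
    | _, _, .monoAn => fun _ hb => False.elim hb
    | _, _, .monoE7 => fun _ hb => False.elim hb
    | _, _, .forgetMono _ => fun _ hb => False.elim hb
    | _, _, .toEmono _ => fun _ hb => False.elim hb
    | _, _, .κAnMono => fun _ hb => False.elim hb
    | _, _, .anMonoToE => fun _ hb => False.elim hb
  -- the induced structure functors on `D•_{≤n}` over any category under `An•[𝒳]`
  let O : (n : ℕ) → {C : Type (u + 1)} → [Category.{u} C] → (Lt.An ⥤ C) →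
      (Lt.subdiagram (DVertex.InFirstRows n)).OverData C := fun n _ _ G =>
    { N := fun a => N a.1 a.2.1 ⋙ G
      μ := fun {a b} e => (Functor.associator _ _ _).symm ≪≫ Functor.isoWhiskerRight (μ e a.2.1 b.2.1) G }
  refine ⟨?_, ?_, ?_⟩
  · -- `n = 5`: `ℰ•` is a core of `D•_{≤4}` (over `ℰ•` through `κ_{An•}⁻¹`)
    exact Lt.isCoreOn_of_overData (O 4 Lt.κAn.inverse)
      (fun a i => match a, i with
        | ⟨_, _⟩, .toE v => (Functor.associator _ _ _ ≪≫ Functor.isoWhiskerLeft (Lt.toE v) Lt.κAn.unitIso.symm ≪≫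
            (Lt.toE v).rightUnitor).symm)
      reach_e5
  · -- `n = 6`: `An•[𝒳]` is a core of `D•_{≤5}`
    exact Lt.isCoreOn_of_overData (O 5 (𝟭 Lt.An))
      (fun a i => match a, i with
        | ⟨_, _⟩, .κAn => (Functor.rightUnitor _).symm)
      reach_an
  · -- `n = 7`: the `ℰ•` of row 7 is a core of `D•_{≤6}` (over `ℰ•` through `κ₂`)
    exact Lt.isCoreOn_of_overData (O 6 Lt.κAn₂.functor)
      (fun a i => match a, i with
        | ⟨_, _⟩, .anToE => (Functor.leftUnitor _).symm)
      reach_e7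

/-! ## The degenerate corner `V(F_mod) = ∅` -/

/-- **The hypothesis `V(F_mod) ≠ ∅` is necessary**: for an EMPTY index set `Vmod` no core structure of
`D•_{≤5}` on `D•_{≤4}` exists (the vertex `□` cannot reach `ℰ•`, contradicting Def 3.5 (iii) "every vertex of `Γ⃗_𝒟`
appears as the initial vertex of a path … with terminal vertex equal to `v_𝒮`"), so `Cor55Cores` fails as typed in
that degenerate corner — which a number field `F_mod` never presents. [cite: MochizukiAbsTopIII2015, Cor 5.5 (i) p.130] -/
theorem not_cor55Cores_of_isEmpty [IsEmpty Vmod] : ¬ Lt.Cor55Cores := by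
  rintro ⟨⟨H, hH, hcore⟩, -, -⟩
  have hc : DVertex.InFirstRows (Vmod := Vmod) (isArc := isArc) 4 .core := ⟨trivial, by simp [DVertex.row]⟩
  obtain ⟨p⟩ := hcore.reaches_obs ⟨.core, hc⟩
  have h := eq_core_of_path_of_isEmpty (P := DVertex.InFirstRows 4) hc (x := .e5) (fun i => by cases i) p
  change ExtVertex.obs = ExtVertex.base _ at h
  cases h

/-- `Cor55Cores L` holds if and only if `V(F_mod)` is nonempty. [cite: MochizukiAbsTopIII2015, Cor 5.5 (i) p.130] -/
theorem cor55Cores_iff_nonempty : Lt.Cor55Cores ↔ Nonempty Vmod := by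
  refine ⟨fun h => ?_, fun _ => Lt.cor55Cores_holds⟩
  by_contra hV
  rw [not_nonempty_iff] at hV
  exact Lt.not_cor55Cores_of_isEmpty h

end LogFrobeniusSettingLtimes

end Literature.AnabelianGeometry.AbsoluteAnabelian
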